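import Literature.MathematicalPhysics.QuantumFieldTheory.Balaban1983to89.B15Prop1SliceNondegeneracyFromRealCoercive
import Literature.MathematicalPhysics.QuantumFieldTheory.Balaban1983to89.B16Ineq19NearFlatSlice
import Literature.Analysis.Calculus.LagrangeHessianRealCoercive

/-!
# `Balaban1983to89.B15Prop1RealCoerciveFromNearFlatExpansion` — [Balaban1989LargeFieldII] = «[LF-II]», p. 357 («The leading term in the expansion is the quadratic form with the
# background field identically equal to 1»), (1.7)–(1.9) p. 358, (1.12) p. 359; [Balaban1989LargeFieldI] = «[IV]», Prop. 1 p. 194; [Balaban1985Variational] = «[15]», Sect. G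
# pp. 305–307: THE (β) LETTER `hposN` OF THE (J0′) PRODUCERS FROM PRINT'S ROAD «(1.9) ⟸ (1.7) + (1.8)» — positivity of the real second variation of the Lagrangian on the real
# kernel of the linearised constraint ⟸ the near-flat expansion (1.7) [PROVED] + a FLAT coercivity letter + a MULTIPLIER letter

Honest framing: statement-level skeleton of published theorems with citation tags; proofs where landed; nothing here is a claim about the
Yang–Mills mass gap.  Cell `pub-ymgap`, HUMAN RULING D-0062 (Track A), seat `pub-ymgap-dag-n12-c` g25 (lane owner N12 = [B15], strategy s1 «first missing estimate»);
count-neutral; N12 NOT discharged; finite 𝕋⁴ at fixed ε; nothing continuum ∕ OS ∕ mass-gap ∕ Clay.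

WHY.  After the LOCATED-E1-HSB repair (r1)–(r3) the (J0′) producer of N12 (`B15Prop1MinimiserFamilyFromThm1AtBaseCentralTower.hMin_atRecord_of_node00Letters_thm1AtBase_central_of_guardOn`,
the lane's capstone `…N12MinimiserFamilyOfClassTowerGuards`, dag-n12-d's knit links) displays per base field, besides print's Theorem-1 rows, the (β) letter

  `hposN : ∀ ℓ₀, Da(0) = ℓ₀ ∘ DΦ₀(0) → ∀ p ≠ 0 real, cplxVec p ∈ S, DΦ₀(0)⟨cplxVec p⟩ = 0 → 0 < d²∕dt² [A(exp(tp)·U₀) − Re ℓ₀(Φ₀(t·p̂))]|₀`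

— positivity of the real second variation of the LAGRANGIAN on the real kernel of the linearised constraint.  No in-edge of N12 speaks this currency (the slice action `a`, the
logarithmic datum coordinates `Φ₀` and the multiplier `ℓ₀` are the w1 lineage's objects).  Print's road to it is [LF-II] p. 358: the second variation of the Wilson action at a
near-flat background is the FLAT quadratic form up to `O(δ)·Σ|p_b|²` ((1.7); p. 357 «the leading term … is the quadratic form with the background field identically equal to 1»),
and the flat form is bounded below on the gauge-fixed constrained subspace ((1.8) ∕ «the bound (1.67) [10] for this form»), whence (1.9).  THIS FILE proves the (β) letter VERBATIM
from three print-shaped letters: (P) FLAT COERCIVITY on the real kernel `cP·Σ_b‖p_b‖² ≤ d²∕ds² A(exp(sp)·1)|₀` (the (1.8)∕(1.67) currency — the honest first missing estimate on the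
multi-scale constrained axial subspace; on one box it is dag-n12-c's PROVED (1.8) `B15Prop1SliceIneq18.sliceNormSq_le` with dag-n12-w3's flat formula), (M) a MULTIPLIER letter
`Re ℓ₀(D²Φ₀(0)[p̂,p̂]) ≤ m·Σ_b‖p_b‖²` ((45) right inverse × first variation × chart curvature — per-height inhabitable), (δ) the background `U₀` within `δ` of `1` on the four bond
variables of every plaquette meeting a bond set `B` carrying the real kernel fields, and the numeric `64(d−1)δ + m < cP`; the (1.7) step is dag-n12-w2's PROVED support-local letter
`B16Ineq19NearFlatSlice.abs_deriv_deriv_wilsonAction4_expMul_su2Chart_sub_one_le_local`, the line calculus is `Literature.Analysis.Calculus.LagrangeHessianRealCoercive`.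

CONTENTS (theorems only; no `def`, no `instance`, no `sorry`).  §1 `deriv_deriv_wilsonAction4_realLine_eq_re_hessian` (`d²∕dt² A(exp(tp)·U₀)|₀ = Re D²a(0)[p̂,p̂]`),
★ `deriv_deriv_lagrangian_realLine_eq` (the (β) row's left-hand side `= d²∕dt² A(exp(tp)·U₀)|₀ − Re ℓ₀(D²Φ₀(0)[p̂,p̂])` for `Φ₀` of class `C²` at `0`, ANY target space);
§2 `secondVariation_ge_flat_sub_local` ([LF-II] (1.7) one-sided, at ANY background `δ`-flat on the plaquettes meeting the field's support; level-generic);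
§3 ★★★ `realSecondVariation_pos_of_flatCoercive_of_multiplier` (the (β) letter from (P) + (M) + (δ) + `64(d−1)δ + m < cP`), ★★ `realSecondVariation_pos_of_coercive_of_multiplier`
(the same from BACKGROUND coercivity `cU·Σ_b‖p_b‖² ≤ d²∕ds² A(exp(sp)·U₀)|₀` and (M) with `m < cU`), `realSecondVariation_pos_of_flatCoercive_of_multiplier_analytic` (§3 with `Φ₀`
analytic at `0`, the producers' regularity currency).
HONEST SCOPE: calculus and one application of a proved (1.7) letter; the coercivity letter (P) and the multiplier letter (M) are DISPLAYED, not proved; nothing of Bałaban's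
estimates is asserted; count-neutral; N12 NOT discharged; K1⁹ NOT closed; the YM mass gap (Clay) is NOT proved by any of this — R4 closes only the conditional finite-𝕋⁴ rung
`BalabanLadder.UV`; nothing continuum ∕ ℝ⁴ ∕ OS.
-/

noncomputable section

namespace Literature.MathematicalPhysics.QuantumFieldTheory.Balaban1983to89.B15Prop1RealCoerciveFromNearFlatExpansion

open Set Metric Filter
open scoped Topology ContDiff BigOperators
open Literature.Analysis.Calculus.LagrangeHessianRealCoercive (deriv_deriv_re_comp_realLine fderiv_fderiv_lagrangian_apply)
open Literature.MathematicalPhysics.QuantumFieldTheory.Balaban1983to89.Node00 (SU coeField)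
open B15Prop1SliceNondegeneracyFromRealCoercive (analyticAt_sliceAction sliceAction_realLine)
open B16Ineq19NearFlatSlice (abs_deriv_deriv_wilsonAction4_expMul_su2Chart_sub_one_le_local)
open B15SU2ChartHolomorphic (expMulC)
open B15Prop1AnalyticExtClause (cplxVec)
open B15Prop1ChartCalculusSU2 (E3)
open B15Prop1ChartSU2 (su2Chart)
open B16Sect1Backgrounds (expMul)
open T4CubeChartGnomonic (SU2)
open T4Continuum GaugeField
open scoped Matrix.Norms.L2Operator

variable {P : Params}

variable (S : Submodule ℂ (VecField P 0 (EuclideanSpace ℂ (Fin 3)))) {U₀ : GaugeField P 0 SU2} {a : S → ℂ}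
  (ha : ∀ X : S, a X = ∑ q : Plaq P 0, (1 - (expMulC (X : VecField P 0 (EuclideanSpace ℂ (Fin 3))) (coeField U₀) ⟨q.src, q.μ⟩ *
    expMulC (X : VecField P 0 (EuclideanSpace ℂ (Fin 3))) (coeField U₀) ⟨q.src.shift q.μ, q.ν⟩ *
    Matrix.adjugate (expMulC (X : VecField P 0 (EuclideanSpace ℂ (Fin 3))) (coeField U₀) ⟨q.src.shift q.ν, q.μ⟩) *
    Matrix.adjugate (expMulC (X : VecField P 0 (EuclideanSpace ℂ (Fin 3))) (coeField U₀) ⟨q.src, q.ν⟩)).trace / 2))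

/-! ## §1  The (β) row's left-hand side in Hessian currency -/

section Calculus

include ha

/-- **THE SECOND VARIATION OF THE WILSON ACTION ALONG A REAL SLICE LINE IS THE DIAGONAL OF THE COMPLEX HESSIAN OF THE SLICE ACTION**:
`d²∕dt² A(expMul su2Chart (t•p) U₀)|₀ = Re D²a(0)[p̂,p̂]`, `p̂ = cplxVec p ∈ S` (the slice action is analytic and its real restriction is the Wilson action).
[cite: Balaban1989LargeFieldII, (1.12) p.359, (1.7) p.358; Balaban1985Variational, Sect. G p.305] -/
theorem deriv_deriv_wilsonAction4_realLine_eq_re_hessian {p : VecField P 0 E3} (hp : cplxVec p ∈ S) :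
    deriv (deriv (fun t : ℝ => wilsonAction4 (expMul su2Chart (t • p) U₀))) 0 =
      (fderiv ℂ (fderiv ℂ a) 0 ⟨cplxVec p, hp⟩ ⟨cplxVec p, hp⟩).re := by
  have ha2 : ContDiffAt ℂ 2 a 0 := (analyticAt_sliceAction S ha 0).contDiffAt
  have hfun : (fun t : ℝ => wilsonAction4 (expMul su2Chart (t • p) U₀)) =
      fun t : ℝ => (a ((0 : S) + (t : ℂ) • ⟨cplxVec p, hp⟩)).re := by
    funext t
    rw [zero_add, sliceAction_realLine S ha hp t, Complex.ofReal_re]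
  rw [hfun, deriv_deriv_re_comp_realLine (⟨cplxVec p, hp⟩ : S) ha2 le_rfl]

/-- ★ **THE (β) ROW'S LEFT-HAND SIDE = SECOND VARIATION OF THE ACTION MINUS THE MULTIPLIER TERM**: for `Φ₀ : S → F` of class `C²` at `0` (any target space) and any `ℓ₀`,
`d²∕dt² [A(expMul su2Chart (t•p) U₀) − Re ℓ₀(Φ₀(t·p̂))]|₀ = d²∕dt² A(expMul su2Chart (t•p) U₀)|₀ − Re ℓ₀(D²Φ₀(0)[p̂,p̂])` — the Hessian of the scalar Lagrangian
`a − ℓ₀∘Φ₀` read along the real line. [cite: Balaban1989LargeFieldII, (1.12) p.359, (1.9) p.358; LuenbergerYe2008, §10.5 p.301] -/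
theorem deriv_deriv_lagrangian_realLine_eq {F : Type*} [NormedAddCommGroup F] [NormedSpace ℂ F] {Φ₀ : S → F} (hΦ : ContDiffAt ℂ 2 Φ₀ 0) (ℓ₀ : F →L[ℂ] ℂ)
    {p : VecField P 0 E3} (hp : cplxVec p ∈ S) :
    deriv (deriv (fun t : ℝ => wilsonAction4 (expMul su2Chart (t • p) U₀) - (ℓ₀ (Φ₀ ((t : ℂ) • ⟨cplxVec p, hp⟩))).re)) 0 =
      deriv (deriv (fun t : ℝ => wilsonAction4 (expMul su2Chart (t • p) U₀))) 0 -
        (ℓ₀ (fderiv ℂ (fderiv ℂ Φ₀) 0 ⟨cplxVec p, hp⟩ ⟨cplxVec p, hp⟩)).re := by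
  have ha2 : ContDiffAt ℂ 2 a 0 := (analyticAt_sliceAction S ha 0).contDiffAt
  have hL : ContDiffAt ℂ 2 (fun X => a X - ℓ₀ (Φ₀ X)) 0 := ha2.sub (ℓ₀.contDiff.contDiffAt.comp _ hΦ)
  have hfun : (fun t : ℝ => wilsonAction4 (expMul su2Chart (t • p) U₀) - (ℓ₀ (Φ₀ ((t : ℂ) • ⟨cplxVec p, hp⟩))).re) =
      fun t : ℝ => ((fun X => a X - ℓ₀ (Φ₀ X)) ((0 : S) + (t : ℂ) • ⟨cplxVec p, hp⟩)).re := by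
    funext t
    rw [zero_add, Complex.sub_re, sliceAction_realLine S ha hp t, Complex.ofReal_re]
  rw [hfun, deriv_deriv_re_comp_realLine (⟨cplxVec p, hp⟩ : S) hL le_rfl, fderiv_fderiv_lagrangian_apply ℓ₀ ha2 hΦ le_rfl,
    Complex.sub_re, ← deriv_deriv_wilsonAction4_realLine_eq_re_hessian S ha hp]

end Calculus

/-! ## §2  [LF-II] (1.7), one-sided and support-local: the second variation at a near-flat background dominates the flat one up to `64(d−1)δ·Σ_b‖p_b‖²` -/

omit S in
/-- **(1.7) ONE-SIDED, SUPPORT-LOCAL, LEVEL-GENERIC**: if the `ℝ³`-valued bond field `p` vanishes off a bond set `B` and the four bond variables of every plaquette meeting `B` are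
within `δ ≥ 0` of `1` under `U`, then `d²∕ds² A(exp(sp)·1)|₀ − 64(d−1)δ·Σ_b‖p_b‖² ≤ d²∕ds² A(exp(sp)·U)|₀` — one line over dag-n12-w2's two-sided letter.
[cite: Balaban1989LargeFieldII, (1.7) p.358, p.357; Balaban1985BackgroundPropagators, (3.10) p.392] -/
theorem secondVariation_ge_flat_sub_local {k : ℕ} (p : VecField P k (EuclideanSpace ℝ (Fin 3))) (U : GaugeField P k SU2) (B : Set (PBond P k))
    (hpB : ∀ b ∉ B, p b = 0) {δ : ℝ} (hδ0 : 0 ≤ δ)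
    (hδ : ∀ q : Plaq P k, ((⟨q.src, q.μ⟩ : PBond P k) ∈ B ∨ (⟨q.src.shift q.μ, q.ν⟩ : PBond P k) ∈ B ∨ (⟨q.src.shift q.ν, q.μ⟩ : PBond P k) ∈ B ∨ (⟨q.src, q.ν⟩ : PBond P k) ∈ B) →
      ‖((U ⟨q.src, q.μ⟩ : SU2) : Matrix (Fin 2) (Fin 2) ℂ) - 1‖ ≤ δ ∧ ‖((U ⟨q.src.shift q.μ, q.ν⟩ : SU2) : Matrix (Fin 2) (Fin 2) ℂ) - 1‖ ≤ δ
        ∧ ‖((U ⟨q.src.shift q.ν, q.μ⟩ : SU2) : Matrix (Fin 2) (Fin 2) ℂ) - 1‖ ≤ δ ∧ ‖((U ⟨q.src, q.ν⟩ : SU2) : Matrix (Fin 2) (Fin 2) ℂ) - 1‖ ≤ δ) :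
    deriv (deriv fun s : ℝ => wilsonAction4 (expMul su2Chart (s • p) (1 : GaugeField P k SU2))) 0 - 64 * ((P.d : ℝ) - 1) * δ * ∑ b : PBond P k, ‖p b‖ ^ 2
      ≤ deriv (deriv fun s : ℝ => wilsonAction4 (expMul su2Chart (s • p) U)) 0 := by
  have h := abs_deriv_deriv_wilsonAction4_expMul_su2Chart_sub_one_le_local p U B hpB hδ0 hδ
  rw [abs_sub_le_iff] at h
  linarith [h.2]

/-! ## §3  The (β) letter from the flat coercivity letter, the multiplier letter and (1.7) -/

section Beta

include ha

/-- ★★★ **THE (β) LETTER `hposN` OF THE (J0′) PRODUCERS FROM PRINT'S ROAD «(1.9) ⟸ (1.7) + (1.8)».**  Objects: a slice `S` (level `0`), the base configuration `U₀`, the slice action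
`a` (its pointwise formula `ha`, exactly as in every producer), slice datum coordinates `Φ₀ : S → F` of class `C²` at `0` (ANY target; at the record `F = (Fin (constrCard 𝔹 k) → ℂ³)`
and `C²` comes from analyticity), a multiplier `ℓ₀`.  LETTERS: (δ) a bond set `B` such that every real slice field in the kernel of `DΦ₀(0)` vanishes off `B`, and `U₀` within
`δ ≥ 0` of `1` on the four bond variables of every plaquette meeting `B`; (P) FLAT COERCIVITY on the real kernel, `cP·Σ_b‖p_b‖² ≤ d²∕ds² A(exp(sp)·1)|₀`; (M) the MULTIPLIER
letter `Re ℓ₀(D²Φ₀(0)[p̂,p̂]) ≤ m·Σ_b‖p_b‖²` on the real kernel; the numeric `64(d−1)δ + m < cP`.  CONCLUSION: for every non-zero real slice field `p` in the kernel,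
`0 < d²∕dt² [A(expMul su2Chart (t•p) U₀) − Re ℓ₀(Φ₀(t·p̂))]|₀` — the `hposN` row VERBATIM (for this `ℓ₀`; the producers' premise `Da(0) = ℓ₀ ∘ DΦ₀(0)` is not needed).
Proof: §1 + §2 + (P) + (M): the left-hand side is `≥ (cP − 64(d−1)δ − m)·Σ_b‖p_b‖² > 0`.
[cite: Balaban1989LargeFieldII, p.357, (1.7)–(1.9) p.358, (1.12) p.359, p.359 («positive, hence invertible on this subspace»); Balaban1989LargeFieldI, Prop. 1 p.194; Balaban1985Variational, Sect. G pp.305–307] -/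
theorem realSecondVariation_pos_of_flatCoercive_of_multiplier {F : Type*} [NormedAddCommGroup F] [NormedSpace ℂ F] {Φ₀ : S → F} (hΦ : ContDiffAt ℂ 2 Φ₀ 0)
    (ℓ₀ : F →L[ℂ] ℂ) (B : Set (PBond P 0))
    (hB : ∀ (p : VecField P 0 E3) (hp : cplxVec p ∈ S), fderiv ℂ Φ₀ 0 ⟨cplxVec p, hp⟩ = 0 → ∀ b ∉ B, p b = 0)
    {δ : ℝ} (hδ0 : 0 ≤ δ)
    (hδ : ∀ q : Plaq P 0, ((⟨q.src, q.μ⟩ : PBond P 0) ∈ B ∨ (⟨q.src.shift q.μ, q.ν⟩ : PBond P 0) ∈ B ∨ (⟨q.src.shift q.ν, q.μ⟩ : PBond P 0) ∈ B ∨ (⟨q.src, q.ν⟩ : PBond P 0) ∈ B) →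
      ‖((U₀ ⟨q.src, q.μ⟩ : SU2) : Matrix (Fin 2) (Fin 2) ℂ) - 1‖ ≤ δ ∧ ‖((U₀ ⟨q.src.shift q.μ, q.ν⟩ : SU2) : Matrix (Fin 2) (Fin 2) ℂ) - 1‖ ≤ δ
        ∧ ‖((U₀ ⟨q.src.shift q.ν, q.μ⟩ : SU2) : Matrix (Fin 2) (Fin 2) ℂ) - 1‖ ≤ δ ∧ ‖((U₀ ⟨q.src, q.ν⟩ : SU2) : Matrix (Fin 2) (Fin 2) ℂ) - 1‖ ≤ δ)
    {cP m : ℝ}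
    -- (P) FLAT coercivity on the real kernel ((1.8) ∕ [10] (1.67) currency)
    (hP : ∀ (p : VecField P 0 E3) (hp : cplxVec p ∈ S), fderiv ℂ Φ₀ 0 ⟨cplxVec p, hp⟩ = 0 →
      cP * ∑ b : PBond P 0, ‖p b‖ ^ 2 ≤ deriv (deriv fun s : ℝ => wilsonAction4 (expMul su2Chart (s • p) (1 : GaugeField P 0 SU2))) 0)
    -- (M) the multiplier letter
    (hM : ∀ (p : VecField P 0 E3) (hp : cplxVec p ∈ S), fderiv ℂ Φ₀ 0 ⟨cplxVec p, hp⟩ = 0 →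
      (ℓ₀ (fderiv ℂ (fderiv ℂ Φ₀) 0 ⟨cplxVec p, hp⟩ ⟨cplxVec p, hp⟩)).re ≤ m * ∑ b : PBond P 0, ‖p b‖ ^ 2)
    (hnum : 64 * ((P.d : ℝ) - 1) * δ + m < cP) :
    ∀ (p : VecField P 0 E3) (hp : cplxVec p ∈ S), p ≠ 0 → fderiv ℂ Φ₀ 0 ⟨cplxVec p, hp⟩ = 0 →
      0 < deriv (deriv (fun t : ℝ => wilsonAction4 (expMul su2Chart (t • p) U₀) - (ℓ₀ (Φ₀ ((t : ℂ) • ⟨cplxVec p, hp⟩))).re)) 0 := by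
  intro p hp hne hker
  -- a non-zero real field has positive `ℓ²` mass
  have hsum : 0 < ∑ b : PBond P 0, ‖p b‖ ^ 2 := by
    obtain ⟨b, hb⟩ : ∃ b, p b ≠ 0 := by
      by_contra h
      push Not at h
      exact hne (funext h)
    have hb' : 0 < ‖p b‖ ^ 2 := by positivity
    exact lt_of_lt_of_le hb' (Finset.single_le_sum (f := fun b => ‖p b‖ ^ 2) (fun _ _ => by positivity) (Finset.mem_univ b))
  -- (1.7) at the background, (P) at the flat configuration, (M) for the multiplier term
  have h17 := secondVariation_ge_flat_sub_local p U₀ B (hB p hp hker) hδ0 hδ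
  have hP' := hP p hp hker
  have hM' := hM p hp hker
  rw [deriv_deriv_lagrangian_realLine_eq S ha hΦ ℓ₀ hp]
  nlinarith

/-- ★★ **THE (β) LETTER FROM BACKGROUND COERCIVITY AND THE MULTIPLIER LETTER** (no (1.7) step): if the second variation of the Wilson action at `U₀` itself is coercive on the real kernel,
`cU·Σ_b‖p_b‖² ≤ d²∕ds² A(exp(sp)·U₀)|₀` ((1.9) at the background, e.g. dag-n12-w2's `B16Ineq19NearFlatSlice.sliceNormSq_le_secondVariation_nearFlat` on one box), and (M) holds with
`m < cU`, then the `hposN` row holds. [cite: Balaban1989LargeFieldII, (1.9) p.358, (1.12) p.359; Balaban1989LargeFieldI, Prop. 1 p.194] -/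
theorem realSecondVariation_pos_of_coercive_of_multiplier {F : Type*} [NormedAddCommGroup F] [NormedSpace ℂ F] {Φ₀ : S → F} (hΦ : ContDiffAt ℂ 2 Φ₀ 0)
    (ℓ₀ : F →L[ℂ] ℂ) {cU m : ℝ}
    (hU : ∀ (p : VecField P 0 E3) (hp : cplxVec p ∈ S), fderiv ℂ Φ₀ 0 ⟨cplxVec p, hp⟩ = 0 →
      cU * ∑ b : PBond P 0, ‖p b‖ ^ 2 ≤ deriv (deriv fun s : ℝ => wilsonAction4 (expMul su2Chart (s • p) U₀)) 0)
    (hM : ∀ (p : VecField P 0 E3) (hp : cplxVec p ∈ S), fderiv ℂ Φ₀ 0 ⟨cplxVec p, hp⟩ = 0 →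
      (ℓ₀ (fderiv ℂ (fderiv ℂ Φ₀) 0 ⟨cplxVec p, hp⟩ ⟨cplxVec p, hp⟩)).re ≤ m * ∑ b : PBond P 0, ‖p b‖ ^ 2)
    (hnum : m < cU) :
    ∀ (p : VecField P 0 E3) (hp : cplxVec p ∈ S), p ≠ 0 → fderiv ℂ Φ₀ 0 ⟨cplxVec p, hp⟩ = 0 →
      0 < deriv (deriv (fun t : ℝ => wilsonAction4 (expMul su2Chart (t • p) U₀) - (ℓ₀ (Φ₀ ((t : ℂ) • ⟨cplxVec p, hp⟩))).re)) 0 := by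
  intro p hp hne hker
  have hsum : 0 < ∑ b : PBond P 0, ‖p b‖ ^ 2 := by
    obtain ⟨b, hb⟩ : ∃ b, p b ≠ 0 := by
      by_contra h
      push Not at h
      exact hne (funext h)
    have hb' : 0 < ‖p b‖ ^ 2 := by positivity
    exact lt_of_lt_of_le hb' (Finset.single_le_sum (f := fun b => ‖p b‖ ^ 2) (fun _ _ => by positivity) (Finset.mem_univ b))
  have hU' := hU p hp hker
  have hM' := hM p hp hker
  rw [deriv_deriv_lagrangian_realLine_eq S ha hΦ ℓ₀ hp]
  nlinarith

/-- **ANALYTIC EDITION** of `realSecondVariation_pos_of_flatCoercive_of_multiplier`: the producers' regularity currency for the slice datum coordinates is analyticity at `0`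
(`B15Prop1SliceNondegeneracyFromRealCoercive[Tower].analyticAt_sliceDatum[_of_guardOn]`), which gives the `C²` hypothesis. [cite: Balaban1989LargeFieldII, (1.7)–(1.9) p.358; Balaban1985Variational, Sect. G p.307, (181) p.307] -/
theorem realSecondVariation_pos_of_flatCoercive_of_multiplier_analytic {F : Type*} [NormedAddCommGroup F] [NormedSpace ℂ F] [CompleteSpace F] {Φ₀ : S → F}
    (hΦ : AnalyticAt ℂ Φ₀ 0) (ℓ₀ : F →L[ℂ] ℂ) (B : Set (PBond P 0))
    (hB : ∀ (p : VecField P 0 E3) (hp : cplxVec p ∈ S), fderiv ℂ Φ₀ 0 ⟨cplxVec p, hp⟩ = 0 → ∀ b ∉ B, p b = 0)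
    {δ : ℝ} (hδ0 : 0 ≤ δ)
    (hδ : ∀ q : Plaq P 0, ((⟨q.src, q.μ⟩ : PBond P 0) ∈ B ∨ (⟨q.src.shift q.μ, q.ν⟩ : PBond P 0) ∈ B ∨ (⟨q.src.shift q.ν, q.μ⟩ : PBond P 0) ∈ B ∨ (⟨q.src, q.ν⟩ : PBond P 0) ∈ B) →
      ‖((U₀ ⟨q.src, q.μ⟩ : SU2) : Matrix (Fin 2) (Fin 2) ℂ) - 1‖ ≤ δ ∧ ‖((U₀ ⟨q.src.shift q.μ, q.ν⟩ : SU2) : Matrix (Fin 2) (Fin 2) ℂ) - 1‖ ≤ δ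
        ∧ ‖((U₀ ⟨q.src.shift q.ν, q.μ⟩ : SU2) : Matrix (Fin 2) (Fin 2) ℂ) - 1‖ ≤ δ ∧ ‖((U₀ ⟨q.src, q.ν⟩ : SU2) : Matrix (Fin 2) (Fin 2) ℂ) - 1‖ ≤ δ)
    {cP m : ℝ}
    (hP : ∀ (p : VecField P 0 E3) (hp : cplxVec p ∈ S), fderiv ℂ Φ₀ 0 ⟨cplxVec p, hp⟩ = 0 →
      cP * ∑ b : PBond P 0, ‖p b‖ ^ 2 ≤ deriv (deriv fun s : ℝ => wilsonAction4 (expMul su2Chart (s • p) (1 : GaugeField P 0 SU2))) 0)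
    (hM : ∀ (p : VecField P 0 E3) (hp : cplxVec p ∈ S), fderiv ℂ Φ₀ 0 ⟨cplxVec p, hp⟩ = 0 →
      (ℓ₀ (fderiv ℂ (fderiv ℂ Φ₀) 0 ⟨cplxVec p, hp⟩ ⟨cplxVec p, hp⟩)).re ≤ m * ∑ b : PBond P 0, ‖p b‖ ^ 2)
    (hnum : 64 * ((P.d : ℝ) - 1) * δ + m < cP) :
    ∀ (p : VecField P 0 E3) (hp : cplxVec p ∈ S), p ≠ 0 → fderiv ℂ Φ₀ 0 ⟨cplxVec p, hp⟩ = 0 →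
      0 < deriv (deriv (fun t : ℝ => wilsonAction4 (expMul su2Chart (t • p) U₀) - (ℓ₀ (Φ₀ ((t : ℂ) • ⟨cplxVec p, hp⟩))).re)) 0 :=
  realSecondVariation_pos_of_flatCoercive_of_multiplier S ha hΦ.contDiffAt ℓ₀ B hB hδ0 hδ hP hM hnum

end Beta

end Literature.MathematicalPhysics.QuantumFieldTheory.Balaban1983to89.B15Prop1RealCoerciveFromNearFlatExpansion

end
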